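import Summits.QuantumFields.YangMills.Theorems.BalabanLadderUVSeamRecResponseVarianceFloor
import Summits.QuantumFields.YangMills.Theorems.BalabanLadderNTMarkovMirrorReflect
import Summits.QuantumFields.YangMills.Theorems.BalabanLadderUVSeamRecResponseMomentsPinning
import Summits.QuantumFields.YangMills.Theses.FiniteRankMirror
import HarnessLib

/-!
# Route `FiniteRankMirror`, LINE g9-1 «two-cube Markov peeling» — the peeling lemmas and the support item `TwoCubePeeling`

Ideator seat ym-idea-8 (generation 9, lens «dual»: the cube-kernel conditional expectation `kerE_Q` as an
`L²`-projection, peeled on both slots of a covariance).  This file proves the route's support item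
`Summit.QuantumFields.YangMills.Theses.FiniteRankMirror.TwoCubePeeling` (stmt-QuantumFields-23838) and the two generic
peeling inequalities used by the cross glue (`CrossPeelingGlue`, stmt-QuantumFields-23839, next file) and by the mirror
version of the line:

* `abs_torusCov_le_two_mul_sqrt` — Cauchy–Schwarz + `E(k − E k)² ≤ E(k − p)²`: `|Cov_T(k₁,k₂)| ≤ 2‖k₁ − p₁‖₂‖k₂ − p₂‖₂`
  for all constants `p₁, p₂`.
* `twoCube_peel` — DLR transfer with an exterior spectator, twice (`ResponseVariance.torusCov_eq_torusCov_kerE`): the kernel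
  mean of cube 2 is a cylinder on its closed collar (`MarkovMirror.isCylinder_kerE`, `kerE_supp_window`), hence a
  spectator for cube 1 when the closed collars are separated in one coordinate direction; then the Cauchy–Schwarz step.
  `|Cov_T(F₁,F₂)| ≤ 2‖kerE_{Q₁}F₁ − p₁‖₂ · ‖kerE_{Q₂}F₂ − p₂‖₂`.
* `mirror_peel` — the Markov mirror factorisation `MarkovMirror.torusCov_reflect_lift_eq_torusCov_reflect_kerE` +
  reflection invariance `ConjugateResponse.torusE_comp_cfgReflect` + the same Cauchy–Schwarz step (one positive-time cube,
  no reflection positivity): `|Cov_T(F₁∘Θ₀, F₂)| ≤ 2‖kerE_Q F₁ − p₁‖₂ · ‖kerE_Q F₂ − p₂‖₂`.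
* `Summit.QuantumFields.YangMills.Theorems.finiteRankMirror_twoCubePeeling : FiniteRankMirror.TwoCubePeeling`.

HONEST FRAMING: folklore DLR bookkeeping on Wilson's finite-torus measure; nothing of E0′, (RM), NT or the mass gap is
proved here; no summit is proved by this line; not Clay.
-/

set_option autoImplicit false

noncomputable section

open MeasureTheory Filter Topology
open Literature.MathematicalPhysics.QuantumFieldTheory Literature.MathematicalPhysics.QuantumLattice
open Literature.Probability.LatticeModels
open Summit.QuantumFields.YangMills.Cruxes.OSLegsFromFemtoAndGap.DlrCollarTransfer
open Summit.QuantumFields.YangMills.Cruxes.OSLegsFromFemtoAndGap.DlrCollarTransfer.StubLower (mem_cubeSites_iff)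
open Summit.QuantumFields.YangMills.Cruxes.NT.MarkovMirror (isCylinder_kerE kerE_supp_window continuous_cfgReflect
  torusCov_reflect_lift_eq_torusCov_reflect_kerE)
open Summit.QuantumFields.YangMills.Cruxes.NT.CumulantPolarisation (torusE_centred_centred torusE_sub)
open Summit.QuantumFields.YangMills.Cruxes.NT.ConjugateResponse (torusE_comp_cfgReflect)
open Summit.QuantumFields.YangMills.Cruxes.NT.Reference (continuous_kerE)
open Summit.QuantumFields.YangMills.Cruxes.NT.BoundaryLaw (abs_kerE_le)
open Summit.QuantumFields.YangMills.Cruxes.UVSeamRec.ResponsePinning (torusE_const)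
open Summit.QuantumFields.YangMills.Cruxes.UVSeamRec.ResponseVariance (sq_torusE_mul_le torusE_sq_le_torusE_mul_self
  torusCov_eq_torusCov_kerE)

namespace Summit.QuantumFields.YangMills.Cruxes.FiniteRankMirrorPeeling

variable (G : Type) [Group G] [TopologicalSpace G] [IsTopologicalGroup G] [CompactSpace G]
  [MeasurableSpace G] [BorelSpace G] (r : LatticeRep G)

/-- **Cauchy–Schwarz + Jensen for torus covariances, recentred at arbitrary constants**: for continuous `k₁`, `k₂`
and all `p₁ p₂`, `|Cov_T(k₁, k₂)| ≤ 2·‖k₁ − p₁‖_{L²(μ_T)}·‖k₂ − p₂‖_{L²(μ_T)}`. [folklore] -/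
theorem abs_torusCov_le_two_mul_sqrt (β : ℝ) (L : ℕ) {k₁ k₂ : LGConfig 4 G → ℝ} (hk₁ : Continuous k₁)
    (hk₂ : Continuous k₂) (p₁ p₂ : ℝ) :
    |torusE G r β L (fun U => k₁ U * k₂ U) - torusE G r β L k₁ * torusE G r β L k₂| ≤
      2 * Real.sqrt (torusE G r β L (fun U => (k₁ U - p₁) ^ 2)) *
        Real.sqrt (torusE G r β L (fun U => (k₂ U - p₂) ^ 2)) := by
  have hX : Continuous fun U => k₁ U - p₁ := hk₁.sub continuous_const
  have hY : Continuous fun U => k₂ U - p₂ := hk₂.sub continuous_const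
  set A := torusE G r β L (fun U => (k₁ U - p₁) ^ 2) with hA
  set B := torusE G r β L (fun U => (k₂ U - p₂) ^ 2) with hB
  have eA : torusE G r β L (fun U => (k₁ U - p₁) * (k₁ U - p₁)) = A := by
    rw [hA]; congr 1; funext U; ring
  have eB : torusE G r β L (fun U => (k₂ U - p₂) * (k₂ U - p₂)) = B := by
    rw [hB]; congr 1; funext U; ring
  have hmX : torusE G r β L (fun U => k₁ U - p₁) = torusE G r β L k₁ - p₁ := by
    rw [torusE_sub G r β L hk₁ continuous_const, torusE_const r]
  have hmY : torusE G r β L (fun U => k₂ U - p₂) = torusE G r β L k₂ - p₂ := by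
    rw [torusE_sub G r β L hk₂ continuous_const, torusE_const r]
  -- second moments dominate squared means (Jensen); in particular they are non-negative
  have jX : (torusE G r β L k₁ - p₁) ^ 2 ≤ A := by
    rw [← hmX, ← eA]; exact torusE_sq_le_torusE_mul_self G r β L hX
  have jY : (torusE G r β L k₂ - p₂) ^ 2 ≤ B := by
    rw [← hmY, ← eB]; exact torusE_sq_le_torusE_mul_self G r β L hY
  have hA0 : 0 ≤ A := le_trans (sq_nonneg _) jX
  have hB0 : 0 ≤ B := le_trans (sq_nonneg _) jY
  -- Cauchy–Schwarz for the recentred mixed moment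
  have cs : torusE G r β L (fun U => (k₁ U - p₁) * (k₂ U - p₂)) ^ 2 ≤ A * B := by
    rw [← eA, ← eB]; exact sq_torusE_mul_le G r β L hX hY
  -- the covariance, recentred
  have hcov : torusE G r β L (fun U => k₁ U * k₂ U) - torusE G r β L k₁ * torusE G r β L k₂ =
      torusE G r β L (fun U => (k₁ U - p₁) * (k₂ U - p₂)) -
        (torusE G r β L k₁ - p₁) * (torusE G r β L k₂ - p₂) := by
    rw [torusE_centred_centred G r β L hk₁ hk₂ p₁ p₂]; ring
  have e1 : |torusE G r β L (fun U => (k₁ U - p₁) * (k₂ U - p₂))| ≤ Real.sqrt A * Real.sqrt B := by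
    rw [← Real.sqrt_mul hA0, ← Real.sqrt_sq_eq_abs]
    exact Real.sqrt_le_sqrt cs
  have e2 : |torusE G r β L k₁ - p₁| ≤ Real.sqrt A := by
    rw [← Real.sqrt_sq_eq_abs]; exact Real.sqrt_le_sqrt jX
  have e3 : |torusE G r β L k₂ - p₂| ≤ Real.sqrt B := by
    rw [← Real.sqrt_sq_eq_abs]; exact Real.sqrt_le_sqrt jY
  rw [hcov]
  calc |torusE G r β L (fun U => (k₁ U - p₁) * (k₂ U - p₂)) -
          (torusE G r β L k₁ - p₁) * (torusE G r β L k₂ - p₂)|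
        ≤ |torusE G r β L (fun U => (k₁ U - p₁) * (k₂ U - p₂))| +
          |(torusE G r β L k₁ - p₁) * (torusE G r β L k₂ - p₂)| := abs_sub _ _
    _ ≤ Real.sqrt A * Real.sqrt B + Real.sqrt A * Real.sqrt B := by
          rw [abs_mul]
          exact add_le_add e1 (mul_le_mul e2 e3 (abs_nonneg _) (Real.sqrt_nonneg _))
    _ = 2 * Real.sqrt A * Real.sqrt B := by ring

omit [MeasurableSpace G] [BorelSpace G] in
/-- Interior links of the cube `(c, b)` are based at sites `z` with `c j ≤ z j < c j + b`. [folklore] -/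
theorem window_of_mem_cubeEdges {c : Fin 4 → ℤ} {b : ℕ} {e : Literature.MathematicalPhysics.QuantumLattice.ZdEdge 4}
    (he : e ∈ cubeEdges c b) (j : Fin 4) : c j ≤ e.1 j ∧ e.1 j < c j + b :=
  (mem_cubeSites_iff _ _ _).1 (fst_mem_cubeSites_of_mem_cubeEdges he) j

/-- **Two-cube Markov peeling, generic-instance form**: two cubes in the coordinate window of the odd torus whose closed
collars are separated in one coordinate direction; bounded continuous cylinder observables carried by the cubes; then for
all constants `p₁ p₂`, `|Cov_T(F₁, F₂)| ≤ 2‖kerE_{Q₁}(F₁) − p₁‖₂‖kerE_{Q₂}(F₂) − p₂‖₂`. [folklore] -/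
theorem twoCube_peel (β : ℝ) (L : ℕ) (c₁ c₂ : Fin 4 → ℤ) (b₁ b₂ : ℕ)
    (hc₁ : ∀ j, -(L : ℤ) + 2 ≤ c₁ j ∧ c₁ j + (b₁ : ℤ) + 3 ≤ (L : ℤ))
    (hc₂ : ∀ j, -(L : ℤ) + 2 ≤ c₂ j ∧ c₂ j + (b₂ : ℤ) + 3 ≤ (L : ℤ))
    (hsep : ∃ j, c₁ j + (b₁ : ℤ) + 3 ≤ c₂ j ∨ c₂ j + (b₂ : ℤ) + 3 ≤ c₁ j)
    {F₁ F₂ : LGConfig 4 G → ℝ} (hF₁ : Continuous F₁) (hF₂ : Continuous F₂) {M₁ M₂ : ℝ}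
    (hM₁ : ∀ U, |F₁ U| ≤ M₁) (hM₂ : ∀ U, |F₂ U| ≤ M₂)
    {S₁ S₂ : Finset (Literature.MathematicalPhysics.QuantumLattice.ZdEdge 4)}
    (hS₁ : IsCylinder F₁ S₁) (hS₂ : IsCylinder F₂ S₂)
    (hW₁ : ∀ e ∈ S₁, ∀ j, c₁ j ≤ e.1 j ∧ e.1 j ≤ c₁ j + b₁)
    (hW₂ : ∀ e ∈ S₂, ∀ j, c₂ j ≤ e.1 j ∧ e.1 j ≤ c₂ j + b₂) (p₁ p₂ : ℝ) :
    |torusE G r β L (fun U => F₁ U * F₂ U) - torusE G r β L F₁ * torusE G r β L F₂| ≤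
      2 * Real.sqrt (torusE G r β L (fun U => (kerE G r β c₁ b₁ U F₁ - p₁) ^ 2)) *
        Real.sqrt (torusE G r β L (fun U => (kerE G r β c₂ b₂ U F₂ - p₂) ^ 2)) := by
  haveI := r.secondCountableTopology
  obtain ⟨j₀, hj₀⟩ := hsep
  -- the cube-kernel means
  have hk₁c : Continuous fun η => kerE G r β c₁ b₁ η F₁ := continuous_kerE G r β c₁ b₁ hF₁ hM₁
  have hk₂c : Continuous fun η => kerE G r β c₂ b₂ η F₂ := continuous_kerE G r β c₂ b₂ hF₂ hM₂
  have hk₂M : ∀ U, |(fun η => kerE G r β c₂ b₂ η F₂) U| ≤ M₂ := fun U => abs_kerE_le G r β c₂ b₂ U hM₂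
  have hk₂S : IsCylinder (fun η => kerE G r β c₂ b₂ η F₂)
      (S₂ ∪ (plaquettesTouching (cubeEdges c₂ b₂)).biUnion plaquetteEdges) :=
    isCylinder_kerE G r β c₂ b₂ hF₂.measurable hS₂
  -- geometry
  have hc₂' : ∀ j, -(L : ℤ) + 1 ≤ c₂ j ∧ c₂ j + (b₂ : ℤ) + 2 ≤ (L : ℤ) + 1 :=
    fun j => ⟨by linarith [(hc₂ j).1], by linarith [(hc₂ j).2]⟩
  have hc₁' : ∀ j, -(L : ℤ) + 1 ≤ c₁ j ∧ c₁ j + (b₁ : ℤ) + 2 ≤ (L : ℤ) + 1 :=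
    fun j => ⟨by linarith [(hc₁ j).1], by linarith [(hc₁ j).2]⟩
  have hoff₁ : ∀ e ∈ S₁, e ∉ cubeEdges c₂ b₂ := by
    intro e he hmem
    have h1 := hW₁ e he j₀
    have h2 := window_of_mem_cubeEdges hmem j₀
    rcases hj₀ with h | h <;> omega
  have hwin₁ : ∀ e ∈ S₁, ∀ j, -(L : ℤ) + 1 ≤ e.1 j ∧ e.1 j ≤ (L : ℤ) - 1 := by
    intro e he j
    have h1 := hW₁ e he j
    have h2 := hc₁ j
    constructor <;> omega
  have hoff₂ : ∀ e ∈ S₂ ∪ (plaquettesTouching (cubeEdges c₂ b₂)).biUnion plaquetteEdges, e ∉ cubeEdges c₁ b₁ := by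
    intro e he hmem
    have h1 := kerE_supp_window hW₂ he j₀
    have h2 := window_of_mem_cubeEdges hmem j₀
    rcases hj₀ with h | h <;> omega
  have hwin₂ : ∀ e ∈ S₂ ∪ (plaquettesTouching (cubeEdges c₂ b₂)).biUnion plaquetteEdges, ∀ j,
      -(L : ℤ) + 1 ≤ e.1 j ∧ e.1 j ≤ (L : ℤ) - 1 := by
    intro e he j
    have h1 := kerE_supp_window hW₂ he j
    have h2 := hc₂ j
    constructor <;> omega
  -- peel slot 2 (spectator `F₁`), then slot 1 (spectator `kerE_{Q₂} F₂`)
  have step1 : torusE G r β L (fun U => F₁ U * F₂ U) - torusE G r β L F₁ * torusE G r β L F₂ =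
      torusE G r β L (fun η => F₁ η * kerE G r β c₂ b₂ η F₂) -
        torusE G r β L F₁ * torusE G r β L (fun η => kerE G r β c₂ b₂ η F₂) :=
    torusCov_eq_torusCov_kerE G r β c₂ b₂ L hc₂' hF₂ hF₁ hM₂ hM₁ hS₂ hS₁ hW₂ hoff₁ hwin₁
  have step2 : torusE G r β L (fun U => kerE G r β c₂ b₂ U F₂ * F₁ U) -
      torusE G r β L (fun η => kerE G r β c₂ b₂ η F₂) * torusE G r β L F₁ =
      torusE G r β L (fun η => kerE G r β c₂ b₂ η F₂ * kerE G r β c₁ b₁ η F₁) -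
        torusE G r β L (fun η => kerE G r β c₂ b₂ η F₂) * torusE G r β L (fun η => kerE G r β c₁ b₁ η F₁) :=
    torusCov_eq_torusCov_kerE G r β c₁ b₁ L hc₁' hF₁ hk₂c hM₁ hk₂M hS₁ hk₂S hW₁ hoff₂ hwin₂
  have e12 : (fun U => kerE G r β c₂ b₂ U F₂ * F₁ U) = fun η => F₁ η * kerE G r β c₂ b₂ η F₂ :=
    funext fun U => mul_comm _ _
  have e21 : (fun η => kerE G r β c₂ b₂ η F₂ * kerE G r β c₁ b₁ η F₁) =
      fun U => kerE G r β c₁ b₁ U F₁ * kerE G r β c₂ b₂ U F₂ := funext fun U => mul_comm _ _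
  rw [e12, e21] at step2
  have hcov : torusE G r β L (fun U => F₁ U * F₂ U) - torusE G r β L F₁ * torusE G r β L F₂ =
      torusE G r β L (fun U => kerE G r β c₁ b₁ U F₁ * kerE G r β c₂ b₂ U F₂) -
        torusE G r β L (fun η => kerE G r β c₁ b₁ η F₁) * torusE G r β L (fun η => kerE G r β c₂ b₂ η F₂) := by
    rw [step1]; linear_combination step2
  rw [hcov]
  exact abs_torusCov_le_two_mul_sqrt G r β L hk₁c hk₂c p₁ p₂

/-- **Mirror peeling, generic-instance form**: one positive-time cube in the coordinate window; bounded continuous cylinder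
observables carried by it; then `|E_T[(F₁∘Θ₀)·F₂] − E_T[F₁]E_T[F₂]| ≤ 2‖kerE_Q(F₁) − p₁‖₂‖kerE_Q(F₂) − p₂‖₂`. [folklore] -/
theorem mirror_peel (β : ℝ) (L : ℕ) (c : Fin 4 → ℤ) (b : ℕ) (hc0 : 1 ≤ c 0)
    (hc : ∀ j, -(L : ℤ) + 2 ≤ c j ∧ c j + (b : ℤ) + 3 ≤ (L : ℤ))
    {F₁ F₂ : LGConfig 4 G → ℝ} (hF₁ : Continuous F₁) (hF₂ : Continuous F₂) {M₁ M₂ : ℝ}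
    (hM₁ : ∀ U, |F₁ U| ≤ M₁) (hM₂ : ∀ U, |F₂ U| ≤ M₂)
    {S₁ S₂ : Finset (Literature.MathematicalPhysics.QuantumLattice.ZdEdge 4)}
    (hS₁ : IsCylinder F₁ S₁) (hS₂ : IsCylinder F₂ S₂)
    (hW₁ : ∀ e ∈ S₁, ∀ j, c j ≤ e.1 j ∧ e.1 j ≤ c j + b)
    (hW₂ : ∀ e ∈ S₂, ∀ j, c j ≤ e.1 j ∧ e.1 j ≤ c j + b) (p₁ p₂ : ℝ) :
    |torusE G r β L (fun U => F₁ (cfgReflect U) * F₂ U) - torusE G r β L F₁ * torusE G r β L F₂| ≤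
      2 * Real.sqrt (torusE G r β L (fun U => (kerE G r β c b U F₁ - p₁) ^ 2)) *
        Real.sqrt (torusE G r β L (fun U => (kerE G r β c b U F₂ - p₂) ^ 2)) := by
  haveI := r.secondCountableTopology
  have hcL : c 0 + (b : ℤ) + 3 ≤ (L : ℤ) := (hc 0).2
  have hc' : ∀ j, -(L : ℤ) + 2 ≤ c j ∧ c j + (b : ℤ) + 2 ≤ (L : ℤ) + 1 :=
    fun j => ⟨(hc j).1, by linarith [(hc j).2]⟩
  have hk₁c : Continuous fun η => kerE G r β c b η F₁ := continuous_kerE G r β c b hF₁ hM₁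
  have hk₂c : Continuous fun η => kerE G r β c b η F₂ := continuous_kerE G r β c b hF₂ hM₂
  have hk₁c' : Continuous fun η => kerE G r β c b (cfgReflect η) F₁ := hk₁c.comp continuous_cfgReflect
  have h := torusCov_reflect_lift_eq_torusCov_reflect_kerE G r β c b L hc0 hcL hc' hF₁ hF₂ hM₁ hM₂ hS₁ hS₂ hW₁ hW₂
  have hmF : torusE G r β L (fun V => F₁ (cfgReflect V)) = torusE G r β L F₁ := torusE_comp_cfgReflect G r β L F₁
  have hsq : torusE G r β L (fun η => (kerE G r β c b (cfgReflect η) F₁ - p₁) ^ 2) =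
      torusE G r β L (fun η => (kerE G r β c b η F₁ - p₁) ^ 2) :=
    torusE_comp_cfgReflect G r β L (fun η => (kerE G r β c b η F₁ - p₁) ^ 2)
  rw [hmF] at h
  rw [h]
  have hb : |torusE G r β L (fun η => kerE G r β c b (cfgReflect η) F₁ * kerE G r β c b η F₂) -
      torusE G r β L (fun η => kerE G r β c b (cfgReflect η) F₁) * torusE G r β L (fun η => kerE G r β c b η F₂)| ≤
      2 * Real.sqrt (torusE G r β L (fun η => (kerE G r β c b (cfgReflect η) F₁ - p₁) ^ 2)) *
        Real.sqrt (torusE G r β L (fun U => (kerE G r β c b U F₂ - p₂) ^ 2)) :=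
    abs_torusCov_le_two_mul_sqrt G r β L hk₁c' hk₂c p₁ p₂
  rw [hsq] at hb
  exact hb

end Summit.QuantumFields.YangMills.Cruxes.FiniteRankMirrorPeeling

/-- **Two-cube Markov peeling** — the support item `TwoCubePeeling` of route `FiniteRankMirror` (stmt-QuantumFields-23838,
LINE g9-1 of ideator seat ym-idea-8). [folklore] -/
theorem Summit.QuantumFields.YangMills.Theorems.finiteRankMirror_twoCubePeeling :
    Summit.QuantumFields.YangMills.Theses.FiniteRankMirror.TwoCubePeeling := by
  intro G _ _ _ _
  letI : MeasurableSpace G := borel G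
  haveI : BorelSpace G := ⟨rfl⟩
  intro r β L c₁ c₂ b₁ b₂ hc₁ hc₂ hsep F₁ F₂ M₁ M₂ S₁ S₂ hF₁ hF₂ hM₁ hM₂ hS₁ hS₂ hW₁ hW₂ p₁ p₂
  exact Summit.QuantumFields.YangMills.Cruxes.FiniteRankMirrorPeeling.twoCube_peel G r β L c₁ c₂ b₁ b₂ hc₁ hc₂ hsep hF₁ hF₂
    hM₁ hM₂ hS₁ hS₂ hW₁ hW₂ p₁ p₂

end
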